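import Literature.NumberTheory.Transcendental.TubbsPeriodsFunction
import Literature.NumberTheory.Transcendental.BWAnalytic
import HarnessLib

/-!
# Tubbs 1990, Theorem 4 (periods form) — the uniform Taylor expansion and Tijdeman's lemma

Topic `Literature/NumberTheory/Transcendental` (trunk T-TRANSCEND). Fourth file of the discharge of
`Literature.NumberTheory.Transcendental.Tubbs1990_thm4_periods` (Tubbs 1990, Thm 4 = Chudnovsky
1984, Ch. 7, Thm 4.1 (i)): the substitute for the zero estimate.

The auxiliary function `F_p(z) = ∑ p(i,j,k) (z-ω₁/2)ⁱ e^{jc(z-ω₁/2)} (℘(z)-e₁)ᵏ` has at every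
point `z_n = ω₁/2 + n₁ω₁ + n₂ω₂` the **same** Taylor expansion in the elliptic variable:
by periodicity `F_p(z_n + h) = ∑_k A_k(n₁ω₁ + n₂ω₂ + h) · (℘(ω₁/2 + h) - e₁)ᵏ`, where
`A_k(u) = ∑_{i,j} p(i,j,k) uⁱ e^{jcu}` are Baker's exponential polynomials
(tree: `expPolynomial`, `TijdemanZeroEstimate.lean`). Since `℘(ω₁/2 + h) - e₁` vanishes to
order exactly `2` at `h = 0` (`℘'(ω₁/2) = 0`, `℘''(ω₁/2) = 6e₁² - g₂/2 ≠ 0`), vanishing of `F_p`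
to order `≥ 2L₁` at `z_n` forces the *leading* coefficient `A_{k₀}` (`k₀` the least `k` with
`p(·,·,k) ≠ 0`) to have a double zero at `n₁ω₁ + n₂ω₂`. Tijdeman's lemma (Baker 1975, Ch. 12,
Lemma 1; tree `card_zeroMultiset_expPolynomial_le`, `tijdeman_points`, constant `30`) then
bounds the number of such points: `2X² ≤ 30 (La·L0 + (‖ω₁‖+‖ω₂‖) X · L0‖c‖)` if this
happens for all `n ∈ [0, X)²`. In the main argument (`TubbsPeriodsConstruction.lean`) this
inequality fails, which closes the extrapolation.

## Contents

* `coefArr p k`, `Acoef` — the exponential polynomials `A_k`;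
* `F_half_add` — `F_p(ω₁/2 + u) = ∑_k A_k(u) (℘(ω₁/2+u) - e₁)ᵏ`; `F_zpt_add` — the same at
  `z_n + h`, with `℘(ω₁/2 + h)`;
* `deriv_deriv_weierstrassP_half_ne_zero` — `℘''(ω₁/2) ≠ 0`;
  `analyticOrderAt_wsub` — `ord₀ (℘(ω₁/2 + ·) - e₁) = 2`;
* `iteratedDeriv_Acoef_eq_zero` — the double zero of the leading coefficient;
* `two_mul_sq_le_of_vanishing` — Tijdeman's count.

## References

* G. V. Chudnovsky, *Contributions to the theory of transcendental numbers* (1984), Ch. 7,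
  Thm 4.1 (i) p. 318. [Chudnovsky1984]
* A. Baker, *Transcendental Number Theory* (1975), Ch. 12 §2, Lemma 1. [BakerTNT1975]
* R. Tubbs, J. Number Theory 35 (1990), Thm 4 (p. 112). [Tubbs1990]
-/

noncomputable section

open Complex Metric Filter Topology Finset
open scoped PeriodPair

namespace Literature.NumberTheory.Transcendental.TubbsPeriods

open Literature.NumberTheory.Transcendental.Chudnovsky (e₁ not_eventually_const_weierstrassP
  derivWeierstrassP_ω₁_div_two)
open Literature.NumberTheory.Transcendental.BrownawellWaldschmidt (expPolynomial_ne_zero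
  differentiable_expPolynomial tijdeman_points)

variable (L : PeriodPair) (c : ℂ) {La L0 L1 : ℕ}

/-! ### The exponential polynomials `A_k` -/

/-- The coefficient array `(i, j) ↦ p(i, j, k)` of the `k`-th elliptic power. [folklore] -/
def coefArr (p : Lam La L0 L1 → ℂ) (k : Fin L1) : Fin La → Fin L0 → ℂ := fun i j => p (i, j, k)

/-- The frequencies `σ_j = j·c`. [folklore] -/
def frq (L0 : ℕ) : Fin L0 → ℂ := fun j => ((j : ℕ) : ℂ) * c

/-- The exponential polynomial `A_k(u) = ∑_{i,j} p(i,j,k) uⁱ e^{jcu}`. [folklore] -/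
def Acoef (p : Lam La L0 L1 → ℂ) (k : Fin L1) : ℂ → ℂ := expPolynomial (coefArr p k) (frq c L0)

/-- `j ↦ j·c` is injective for `c ≠ 0`. [folklore] -/
lemma frq_injective (hc : c ≠ 0) (L0 : ℕ) : Function.Injective (frq c L0) := by
  intro j j' h
  unfold frq at h
  have := mul_right_cancel₀ hc h
  exact Fin.ext (by exact_mod_cast this)

/-- `‖j·c‖ ≤ L0 ‖c‖` for `j < L0`. [folklore] -/
lemma norm_frq_le (L0 : ℕ) (j : Fin L0) : ‖frq c L0 j‖ ≤ L0 * ‖c‖ := by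
  unfold frq
  rw [norm_mul, Complex.norm_natCast]
  have : ((j : ℕ) : ℝ) ≤ L0 := by exact_mod_cast j.isLt.le
  exact mul_le_mul_of_nonneg_right this (norm_nonneg _)

/-- **Uniform expansion**: `F_p(ω₁/2 + u) = ∑_k A_k(u) (℘(ω₁/2 + u) - e₁)ᵏ`. [folklore] -/
theorem F_half_add (p : Lam La L0 L1 → ℂ) (u : ℂ) :
    F L c p (L.ω₁ / 2 + u) = ∑ k : Fin L1, Acoef c p k u * (℘[L] (L.ω₁ / 2 + u) - e₁ L) ^ (k : ℕ) := by
  unfold F Acoef expPolynomial coefArr frq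
  have hu : L.ω₁ / 2 + u - L.ω₁ / 2 = u := by ring
  simp_rw [hu]
  simp only [Fintype.sum_prod_type, Finset.sum_mul]
  conv_rhs => rw [Finset.sum_comm]
  refine Finset.sum_congr rfl fun i _ => ?_
  rw [Finset.sum_comm]
  refine Finset.sum_congr rfl fun k _ => Finset.sum_congr rfl fun j _ => ?_
  ring

/-- **The expansion at the points `z_n`**: `F_p(z_n + h) = ∑_k A_k(n₁ω₁+n₂ω₂ + h) (℘(ω₁/2+h) - e₁)ᵏ`
(the elliptic factor does not depend on `n`). [cite: Chudnovsky1984, Ch. 7 Thm 4.1 p. 318] -/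
theorem F_zpt_add (p : Lam La L0 L1 → ℂ) (n : ℕ × ℕ) (h : ℂ) :
    F L c p (zpt L n + h) =
      ∑ k : Fin L1, Acoef c p k (lvec L n + h) * (℘[L] (L.ω₁ / 2 + h) - e₁ L) ^ (k : ℕ) := by
  have h1 : zpt L n + h = L.ω₁ / 2 + (lvec L n + h) := by unfold zpt; ring
  rw [h1, F_half_add, ← h1, weierstrassP_zpt_add]

/-! ### The elliptic variable `℘(ω₁/2 + h) - e₁` vanishes to order exactly `2` -/

/-- `℘''(ω₁/2) ≠ 0`: otherwise `6e₁² - g₂/2 = 0` and the constant `e₁` would solve the initial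
value problem `w'' = 6w² - g₂/2`, `w(0) = e₁`, `w'(0) = 0` solved by `℘(ω₁/2 + z)`, so that `℘`
would be constant near `ω₁/2` (`not_eventually_const_weierstrassP`). [folklore] -/
theorem six_mul_e₁_sq_sub_ne_zero : 6 * e₁ L ^ 2 - L.g₂ / 2 ≠ 0 := by
  intro h0
  have hz₀ : L.ω₁ / 2 ∉ L.lattice := L.ω₁_div_two_notMem_lattice
  set w₁ : ℂ → ℂ := fun z ↦ ℘[L] (L.ω₁ / 2 + z) with hw₁
  set w₂ : ℂ → ℂ := fun _ ↦ e₁ L with hw₂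
  have hPa : AnalyticAt ℂ ℘[L] (L.ω₁ / 2) := L.analyticOnNhd_weierstrassP _ hz₀
  have h₁ : AnalyticAt ℂ w₁ 0 := by
    have : AnalyticAt ℂ ℘[L] (L.ω₁ / 2 + 0) := by simpa using hPa
    exact this.comp (analyticAt_const.add analyticAt_id)
  have h₂ : AnalyticAt ℂ w₂ 0 := analyticAt_const
  have hopen : IsOpen ((L.lattice : Set ℂ)ᶜ) := L.isClosed_lattice.isOpen_compl
  have hca : Continuous fun z : ℂ ↦ L.ω₁ / 2 + z := by fun_prop
  have hev₁ : ∀ᶠ z in 𝓝 (0 : ℂ), L.ω₁ / 2 + z ∉ L.lattice := by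
    have : Tendsto (fun z : ℂ ↦ L.ω₁ / 2 + z) (𝓝 0) (𝓝 (L.ω₁ / 2)) := by
      simpa using hca.tendsto (0 : ℂ)
    exact this.eventually (hopen.mem_nhds hz₀)
  have hd₁ : deriv w₁ = fun z ↦ ℘'[L] (L.ω₁ / 2 + z) := by
    ext z; rw [hw₁, deriv_comp_const_add, L.deriv_weierstrassP]
  have hode₁ : ∀ᶠ z in 𝓝 0, deriv (deriv w₁) z = 6 * w₁ z ^ 2 - L.g₂ / 2 := by
    filter_upwards [hev₁] with z hz
    rw [hd₁, deriv_comp_const_add (f := ℘'[L]), L.deriv_derivWeierstrassP hz]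
  have hode₂ : ∀ᶠ z in 𝓝 0, deriv (deriv w₂) z = 6 * w₂ z ^ 2 - L.g₂ / 2 := by
    refine Filter.Eventually.of_forall fun z => ?_
    have h1 : deriv (deriv w₂) z = 0 := by simp [hw₂]
    rw [h1, hw₂]
    exact h0.symm
  have hloc : w₁ =ᶠ[𝓝 0] w₂ :=
    PeriodPair.eventuallyEq_of_deriv_deriv_eq h₁ h₂ hode₁ hode₂ (by simp [hw₁, hw₂, e₁])
      (by rw [hd₁]; simp [hw₂, derivWeierstrassP_ω₁_div_two])
  apply not_eventually_const_weierstrassP L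
  have hmap : map (fun z : ℂ ↦ L.ω₁ / 2 + z) (𝓝 0) = 𝓝 (L.ω₁ / 2) :=
    map_add_left_nhds_zero (L.ω₁ / 2)
  rw [← hmap, Filter.eventually_map]
  filter_upwards [hloc] with z hz
  have hz' : ℘[L] (L.ω₁ / 2 + z) = e₁ L := by simpa [hw₁, hw₂] using hz
  rw [hz']
  rfl

/-- The elliptic variable `wsub h = ℘(ω₁/2 + h) - e₁`. [folklore] -/
def wsub (h : ℂ) : ℂ := ℘[L] (L.ω₁ / 2 + h) - e₁ L

/-- `wsub` is analytic at `0`. [folklore] -/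
lemma analyticAt_wsub : AnalyticAt ℂ (wsub L) 0 := by
  have hPa : AnalyticAt ℂ ℘[L] (L.ω₁ / 2 + 0) := by
    simpa using L.analyticOnNhd_weierstrassP _ L.ω₁_div_two_notMem_lattice
  unfold wsub
  exact (hPa.comp (analyticAt_const.add analyticAt_id)).sub analyticAt_const

/-- `wsub` is analytic everywhere it will be used: at every `h` with `ω₁/2 + h ∉ Λ`. [folklore] -/
lemma analyticAt_wsub_of {h : ℂ} (hh : L.ω₁ / 2 + h ∉ L.lattice) : AnalyticAt ℂ (wsub L) h := by
  unfold wsub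
  exact ((L.analyticOnNhd_weierstrassP _ hh).comp (analyticAt_const.add analyticAt_id)).sub
    analyticAt_const

/-- **`ord₀ (℘(ω₁/2 + ·) - e₁) = 2`.** [folklore] -/
theorem analyticOrderAt_wsub : analyticOrderAt (wsub L) 0 = (2 : ℕ) := by
  have ha := analyticAt_wsub L
  rw [analyticOrderAt_eq_nat_iff_iteratedDeriv_eq_zero ha]
  have hz₀ : L.ω₁ / 2 ∉ L.lattice := L.ω₁_div_two_notMem_lattice
  have hopen : IsOpen ((L.lattice : Set ℂ)ᶜ) := L.isClosed_lattice.isOpen_compl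
  have hca : Continuous fun z : ℂ ↦ L.ω₁ / 2 + z := by fun_prop
  have hev : ∀ᶠ z in 𝓝 (0 : ℂ), L.ω₁ / 2 + z ∉ L.lattice := by
    have : Tendsto (fun z : ℂ ↦ L.ω₁ / 2 + z) (𝓝 0) (𝓝 (L.ω₁ / 2)) := by
      simpa using hca.tendsto (0 : ℂ)
    exact this.eventually (hopen.mem_nhds hz₀)
  have hd : deriv (wsub L) = fun z ↦ ℘'[L] (L.ω₁ / 2 + z) := by
    ext z
    unfold wsub
    rw [deriv_sub_const, deriv_comp_const_add, L.deriv_weierstrassP]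
  have hdd : ∀ᶠ z in 𝓝 0, deriv (deriv (wsub L)) z = 6 * ℘[L] (L.ω₁ / 2 + z) ^ 2 - L.g₂ / 2 := by
    filter_upwards [hev] with z hz
    rw [hd, deriv_comp_const_add (f := ℘'[L]), L.deriv_derivWeierstrassP hz]
  refine ⟨fun k hk => ?_, ?_⟩
  · interval_cases k
    · simp [wsub, e₁]
    · rw [iteratedDeriv_one, hd]
      simp [derivWeierstrassP_ω₁_div_two]
  · rw [iteratedDeriv_succ, iteratedDeriv_one, hdd.self_of_nhds]
    simpa [e₁] using six_mul_e₁_sq_sub_ne_zero L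

/-! ### The double zero of the leading coefficient -/

/-- `A_k` is entire. [folklore] -/
lemma differentiable_Acoef (p : Lam La L0 L1 → ℂ) (k : Fin L1) : Differentiable ℂ (Acoef c p k) :=
  differentiable_expPolynomial _ _

/-- `A_k = 0` when the `k`-th coefficient array vanishes. [folklore] -/
lemma Acoef_eq_zero_of {p : Lam La L0 L1 → ℂ} {k : Fin L1} (hk : coefArr p k = 0) : Acoef c p k = 0 := by
  funext u
  simp [Acoef, expPolynomial, hk]

/-- **The double zero.** If `F_p` vanishes to order `≥ 2L₁` at `z_n` and `k₀` is such that
`p(·,·,k) = 0` for all `k < k₀`, then `A_{k₀}` and `A_{k₀}'` vanish at `n₁ω₁ + n₂ω₂`.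
[cite: Chudnovsky1984, Ch. 7 Thm 4.1 p. 318] -/
theorem iteratedDeriv_Acoef_eq_zero (p : Lam La L0 L1 → ℂ) (k₀ : Fin L1)
    (hk₀ : ∀ k : Fin L1, k < k₀ → coefArr p k = 0) (n : ℕ × ℕ)
    (hF : ∀ t < 2 * L1, iteratedDeriv t (F L c p) (zpt L n) = 0) :
    ∀ j < 2, iteratedDeriv j (Acoef c p k₀) (lvec L n) = 0 := by
  -- the functions of `h`
  set g : ℂ → ℂ := fun h => F L c p (zpt L n + h) with hg
  set a : ℂ → ℂ := fun h => Acoef c p k₀ (lvec L n + h) with ha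
  set R : ℂ → ℂ := fun h => ∑ k : Fin L1, if (k₀ : ℕ) < k then
      Acoef c p k (lvec L n + h) * wsub L h ^ ((k : ℕ) - k₀ - 1) else 0 with hR
  -- the decomposition `g = a · wsub^{k₀} + wsub^{k₀+1} · R`
  have hdec : ∀ h, g h = a h * wsub L h ^ (k₀ : ℕ) + wsub L h ^ ((k₀ : ℕ) + 1) * R h := by
    intro h
    simp only [hg, ha, hR]
    rw [F_zpt_add, Finset.mul_sum]
    have hsplit : ∀ k : Fin L1, Acoef c p k (lvec L n + h) * (℘[L] (L.ω₁ / 2 + h) - e₁ L) ^ (k : ℕ) =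
        (if k = k₀ then Acoef c p k₀ (lvec L n + h) * wsub L h ^ (k₀ : ℕ) else 0) +
          wsub L h ^ ((k₀ : ℕ) + 1) * (if (k₀ : ℕ) < k then
            Acoef c p k (lvec L n + h) * wsub L h ^ ((k : ℕ) - k₀ - 1) else 0) := by
      intro k
      rcases lt_trichotomy k k₀ with hlt | rfl | hgt
      · rw [Acoef_eq_zero_of c (hk₀ k hlt)]
        have h1 : ¬ (k = k₀) := ne_of_lt hlt
        have h2 : ¬ ((k₀ : ℕ) < k) := not_lt.mpr (Fin.le_def.mp hlt.le)
        simp [h1, h2]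
      · simp [wsub]
      · have h1 : ¬ (k = k₀) := ne_of_gt hgt
        have h2 : (k₀ : ℕ) < k := Fin.lt_def.mp hgt
        rw [if_neg h1, if_pos h2, zero_add]
        have : (k : ℕ) = ((k₀ : ℕ) + 1) + ((k : ℕ) - k₀ - 1) := by omega
        conv_lhs => rw [show (℘[L] (L.ω₁ / 2 + h) - e₁ L) = wsub L h from rfl, this, pow_add]
        ring
    rw [Finset.sum_congr rfl fun k _ => hsplit k, Finset.sum_add_distrib, Finset.sum_ite_eq' ,
      if_pos (Finset.mem_univ _)]
  -- analyticity at `0`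
  have hz₀ : zpt L n ∉ L.lattice := zpt_notMem L n
  have hga : AnalyticAt ℂ g 0 := by
    have : AnalyticAt ℂ (F L c p) (zpt L n + 0) := by simpa using analyticAt_F L c p hz₀
    exact this.comp (analyticAt_const.add analyticAt_id)
  have haa : AnalyticAt ℂ a 0 :=
    ((differentiable_Acoef c p k₀).analyticAt _).comp (analyticAt_const.add analyticAt_id)
  have hwa : AnalyticAt ℂ (wsub L) 0 := analyticAt_wsub L
  have hRa : AnalyticAt ℂ R 0 := by
    rw [hR]
    refine Finset.analyticAt_fun_sum _ fun k _ => ?_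
    split_ifs
    · exact (((differentiable_Acoef c p k).analyticAt _).comp
        (analyticAt_const.add analyticAt_id)).mul (hwa.pow _)
    · exact analyticAt_const
  -- orders
  have hordg : ((2 * L1 : ℕ) : ℕ∞) ≤ analyticOrderAt g 0 := by
    rw [natCast_le_analyticOrderAt_iff_iteratedDeriv_eq_zero hga]
    intro t ht
    have := congrFun (iteratedDeriv_comp_const_add t (F L c p) (zpt L n)) 0
    rw [hg]
    rw [this, add_zero]
    exact hF t ht
  have hordw : analyticOrderAt (wsub L) 0 = (2 : ℕ) := analyticOrderAt_wsub L
  have hk₀L : (k₀ : ℕ) + 1 ≤ L1 := k₀.isLt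
  -- `ord (wsub^{k₀+1} R) ≥ 2k₀ + 2`
  have hord2 : ((2 * (k₀ : ℕ) + 2 : ℕ) : ℕ∞) ≤ analyticOrderAt (fun h => wsub L h ^ ((k₀ : ℕ) + 1) * R h) 0 := by
    have hmul := analyticOrderAt_mul (hwa.pow ((k₀ : ℕ) + 1)) hRa
    have hpow := analyticOrderAt_pow hwa ((k₀ : ℕ) + 1)
    rw [show (fun h => wsub L h ^ ((k₀ : ℕ) + 1) * R h) = (wsub L ^ ((k₀ : ℕ) + 1)) * R from rfl,
      hmul, hpow, hordw]
    have : ((2 * (k₀ : ℕ) + 2 : ℕ) : ℕ∞) = ((k₀ : ℕ) + 1) • ((2 : ℕ) : ℕ∞) := by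
      rw [nsmul_eq_mul]; push_cast; ring
    rw [this]
    exact le_self_add
  -- hence `ord (a · wsub^{k₀}) ≥ 2k₀ + 2`
  have hord1 : ((2 * (k₀ : ℕ) + 2 : ℕ) : ℕ∞) ≤ analyticOrderAt (fun h => a h * wsub L h ^ (k₀ : ℕ)) 0 := by
    have heq : (fun h => a h * wsub L h ^ (k₀ : ℕ)) = g - fun h => wsub L h ^ ((k₀ : ℕ) + 1) * R h := by
      funext h; simp [hdec h]
    rw [heq]
    refine le_trans (le_min ?_ hord2) le_analyticOrderAt_sub
    exact le_trans (by exact_mod_cast (by omega : 2 * (k₀ : ℕ) + 2 ≤ 2 * L1)) hordg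
  -- and `ord a ≥ 2`
  have horda : ((2 : ℕ) : ℕ∞) ≤ analyticOrderAt a 0 := by
    have hmul := analyticOrderAt_mul haa (hwa.pow (k₀ : ℕ))
    have hpow := analyticOrderAt_pow hwa (k₀ : ℕ)
    rw [show (fun h => a h * wsub L h ^ (k₀ : ℕ)) = a * (wsub L ^ (k₀ : ℕ)) from rfl, hmul, hpow,
      hordw] at hord1
    have h2k : ((k₀ : ℕ) • ((2 : ℕ) : ℕ∞)) = ((2 * (k₀ : ℕ) : ℕ) : ℕ∞) := by
      rw [nsmul_eq_mul]; push_cast; ring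
    rw [h2k] at hord1
    have hne : ((2 * (k₀ : ℕ) : ℕ) : ℕ∞) ≠ ⊤ := ENat.coe_ne_top _
    have : ((2 : ℕ) : ℕ∞) + ((2 * (k₀ : ℕ) : ℕ) : ℕ∞) ≤ analyticOrderAt a 0 + ((2 * (k₀ : ℕ) : ℕ) : ℕ∞) := by
      calc ((2 : ℕ) : ℕ∞) + ((2 * (k₀ : ℕ) : ℕ) : ℕ∞) = ((2 * (k₀ : ℕ) + 2 : ℕ) : ℕ∞) := by
            push_cast; ring
        _ ≤ _ := hord1
    exact (ENat.add_le_add_iff_right hne).mp this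
  -- translate back to `A_{k₀}` at `lvec n`
  intro j hj
  have h1 : iteratedDeriv j a 0 = 0 :=
    (natCast_le_analyticOrderAt_iff_iteratedDeriv_eq_zero haa).mp horda j hj
  have := congrFun (iteratedDeriv_comp_const_add j (Acoef c p k₀) (lvec L n)) 0
  rw [ha] at h1
  rw [this, add_zero] at h1
  exact h1

/-! ### Tijdeman's count -/

/-- **Tijdeman's lemma applied.** If `p ≠ 0`, `c ≠ 0` and `F_p` vanishes to order `≥ 2L₁` at
all points `z_n`, `n ∈ [0, X)²` (`X ≥ 1`), then `2X² ≤ 30 (La·L0 + (‖ω₁‖+‖ω₂‖)X · L0‖c‖)`: the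
leading exponential polynomial `A_{k₀} ≢ 0` has double zeros at the `X²` points `n₁ω₁ + n₂ω₂`
of the disc `|u| ≤ (‖ω₁‖+‖ω₂‖)X`, and Tijdeman's lemma bounds their number.
[cite: BakerTNT1975, Ch. 12 §2 Lemma 1] -/
theorem two_mul_sq_le_of_vanishing (hc : c ≠ 0) {X : ℕ} {p : Lam La L0 L1 → ℂ} (hp : p ≠ 0)
    (hF : ∀ n : ℕ × ℕ, n.1 < X → n.2 < X → ∀ t < 2 * L1, iteratedDeriv t (F L c p) (zpt L n) = 0) :
    (2 * X ^ 2 : ℝ) ≤ 30 * (La * L0 + (‖L.ω₁‖ + ‖L.ω₂‖) * X * (L0 * ‖c‖)) := by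
  classical
  -- the least `k` with a nonzero coefficient array
  have hex : ∃ k : Fin L1, coefArr p k ≠ 0 := by
    by_contra hall
    push Not at hall
    apply hp
    funext l
    have := congrFun (congrFun (hall l.2.2) l.1) l.2.1
    simpa [coefArr] using this
  obtain ⟨k₀, hk₀ne, hk₀min⟩ : ∃ k₀ : Fin L1, coefArr p k₀ ≠ 0 ∧ ∀ k : Fin L1, k < k₀ → coefArr p k = 0 := by
    obtain ⟨k₀, hk₀, hmin⟩ := (Finset.univ.filter fun k : Fin L1 => coefArr p k ≠ 0).exists_min_image
      id (by obtain ⟨k, hk⟩ := hex; exact ⟨k, by simp [hk]⟩)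
    refine ⟨k₀, (Finset.mem_filter.mp hk₀).2, fun k hk => ?_⟩
    by_contra hne
    have := hmin k (by simp [hne])
    exact absurd hk (not_lt.mpr this)
  -- the nonzero exponential polynomial with double zeros
  have hA : Acoef c p k₀ ≠ 0 := expPolynomial_ne_zero (frq_injective c hc L0) hk₀ne
  set s : Finset ℂ := ((Finset.range X) ×ˢ (Finset.range X)).image (lvec L) with hs
  have hinj : Function.Injective (lvec L) := by
    intro n n' h
    have h' : zpt L n = zpt L n' := by unfold zpt; rw [h]
    -- injectivity of `zpt`
    rcases n with ⟨a, b⟩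
    rcases n' with ⟨a', b'⟩
    simp only [zpt, lvec] at h'
    have h'' : ((a : ℝ) - a') • L.ω₁ + ((b : ℝ) - b') • L.ω₂ = 0 := by
      simp only [Complex.real_smul]
      push_cast
      linear_combination h'
    obtain ⟨h1, h2⟩ := LinearIndependent.pair_iff.mp L.indep _ _ h''
    have ha : a = a' := by exact_mod_cast sub_eq_zero.mp h1
    have hb : b = b' := by exact_mod_cast sub_eq_zero.mp h2
    rw [ha, hb]
  have hcard : s.card = X ^ 2 := by
    rw [hs, Finset.card_image_of_injective _ hinj, Finset.card_product, Finset.card_range, sq]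
  have hsnorm : ∀ u ∈ s, ‖u‖ ≤ (‖L.ω₁‖ + ‖L.ω₂‖) * X := by
    intro u hu
    rw [hs, Finset.mem_image] at hu
    obtain ⟨n, hn, rfl⟩ := hu
    rw [Finset.mem_product, Finset.mem_range, Finset.mem_range] at hn
    have h1' : (n.1 : ℝ) ≤ X := by exact_mod_cast hn.1.le
    have h2' : (n.2 : ℝ) ≤ X := by exact_mod_cast hn.2.le
    unfold lvec
    calc ‖(n.1 : ℂ) * L.ω₁ + (n.2 : ℂ) * L.ω₂‖ ≤ ‖(n.1 : ℂ) * L.ω₁‖ + ‖(n.2 : ℂ) * L.ω₂‖ :=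
          norm_add_le _ _
      _ = n.1 * ‖L.ω₁‖ + n.2 * ‖L.ω₂‖ := by
          rw [norm_mul, norm_mul, Complex.norm_natCast, Complex.norm_natCast]
      _ ≤ X * ‖L.ω₁‖ + X * ‖L.ω₂‖ := by gcongr
      _ = (‖L.ω₁‖ + ‖L.ω₂‖) * X := by ring
  have hzero : ∀ u ∈ s, ∀ j < 2, iteratedDeriv j (Acoef c p k₀) u = 0 := by
    intro u hu j hj
    rw [hs, Finset.mem_image] at hu
    obtain ⟨n, hn, rfl⟩ := hu
    rw [Finset.mem_product, Finset.mem_range, Finset.mem_range] at hn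
    exact iteratedDeriv_Acoef_eq_zero L c p k₀ hk₀min n (hF n hn.1 hn.2) j hj
  have hr : (0 : ℝ) ≤ (‖L.ω₁‖ + ‖L.ω₂‖) * X := by positivity
  have h := tijdeman_points (coefArr p k₀) (frq c L0) (norm_frq_le c L0) hr hA s hsnorm 2 hzero
  rw [hcard] at h
  push_cast at h
  linarith

end Literature.NumberTheory.Transcendental.TubbsPeriods

end
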